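import Summits.QuantumFields.YangMills.Theorems.CentreWallReflectionSlabOdd1
import HarnessLib

/-!
# Slab decomposition of the four-torus Wilson weight, IX: the wall reflection bound on ODD tori
# (crux `CentreWallReflection.WallReflection` ⟨stmt-QuantumFields-23707⟩, line `birth`, stub `stub_instantiate`; planner ym-idea-4 g18)

Stokes core (pinned ladder plaquette from a far transported holonomy), the ABSOLUTE bad-bond bound `∫∫𝟙[far]Ψ_1 ≤ (n+1)e^{−βδ/(n+1)²}`,
the wall ring weight at slice `j`, and `core_odd`: on a torus of odd side `n+1 = 2m+1`, the registered odd ring lemma `stub_oddRing` with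
`Ψ = Ψ_m`, `K = Ψ_1` (positive semi-definite), the close pairs `∃u, N − Re tr ρ(P(a)⁻¹uP(a')u⁻¹) < δ`, gives `Z(z) ≤ 8εZ(1) ≤ 16εZ(1)`.
HONEST FRAMING: lattice bookkeeping toward ONE crux of a draft route (fixed torus, finite lattice); nothing here proves the route's target
`MarginalTwistOnset.FixedTorusCriterionFailure`, any continuum statement, or the Yang–Mills mass gap.  THEOREMS ONLY (no `def`, no `sorry`),
standard axioms.  References: [cite: OsterwalderSeiler1978, §2]; [cite: tHooft1979]; E. T. Tomboulis, L. G. Yaffe, CMP 100 (1985) 313;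
[cite: Luscher1983, §2].
-/

set_option autoImplicit false

noncomputable section

open scoped BigOperators
open MeasureTheory Literature.MathematicalPhysics.QuantumFieldTheory

namespace Summit.QuantumFields.YangMills.Theorems.CentreWallReflection.Slab

open MeasureTheory
open Summit.QuantumFields.YangMills.Theorems.FemtoTransferGap.FluxReflection (abs_ind_le_one ind_nonneg ind_le_one weight_mono)

section OddCore

variable {n : ℕ} {G : Type} [Group G] [TopologicalSpace G] [IsTopologicalGroup G] [CompactSpace G]
  [MeasurableSpace G] [BorelSpace G] [SecondCountableTopology G] {N : ℕ} (ρ : G →* Matrix (Fin N) (Fin N) ℂ) (μ ν : Fin 4)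


/-- **The wall reflection bound on an odd torus** (`n + 1 = 2m + 1`): `Z(z) ≤ 16 ε Z(1)` from the odd ring lemma `stub_oddRing` with the
middle-bond kernel `K = Ψ_1` (positive semi-definite by `slabKernel_one_psd`). -/
theorem core_odd (hO : OddRingP) (hn : 1 ≤ n) {m : ℕ} (hm : n + 1 = 2 * m + 1) (hρ : Continuous ρ)
    (hU : ∀ g, ρ g ∈ Matrix.unitaryGroup (Fin N) ℂ) {q : {p : Fin 4 × Fin 4 // p.1 < p.2}} (hμ : q.1.1 = μ) (hν : q.1.2 = ν)
    {z : G} (hz : z ∈ Subgroup.center G) {O : G → ℕ} {Wset : Set G} {δ ε β : ℝ} (hOm : Measurable O) (hWm : MeasurableSet Wset)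
    (hOc : ∀ g h : G, O (h * g * h⁻¹) = O g) (hWc : ∀ g h : G, h * g * h⁻¹ ∈ Wset ↔ g ∈ Wset)
    (hsep : ∀ g : G, g ∉ Wset → O (z * g) ≠ O g)
    (hloc : ∀ g g' : G, (N : ℝ) - (ρ (g⁻¹ * g')).trace.re < δ → g ∉ Wset → g' ∉ Wset → O g = O g')
    (hε : 0 < ε) (hε1 : ε ≤ 1) (hβ : 0 ≤ β)
    (hwall : ∑ t ∈ Finset.range (n + 1), wallWeight (n := n) ρ μ ν β Wset t ≤ ε ^ 2 * ∫ W, boltz ρ β W ∂(MeasureTheory.Measure.pi (fun _ : Edge 4 (n + 1) => haarProbability G)))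
    (hpin : (((n + 1 : ℕ) : ℝ) ^ 2) * Real.exp (-((δ / (((n + 1 : ℕ) : ℝ) ^ 2)) * β)) ≤ ε ^ 2 * ∫ W, boltz ρ β W ∂(MeasureTheory.Measure.pi (fun _ : Edge 4 (n + 1) => haarProbability G))) :
    ∫ W, Real.exp (-(β * ∑ p : Plaquette 4 (n + 1), twistedCost ρ q z W p)) ∂(MeasureTheory.Measure.pi (fun _ : Edge 4 (n + 1) => haarProbability G)) ≤ 16 * ε * ∫ W, boltz ρ β W ∂(MeasureTheory.Measure.pi (fun _ : Edge 4 (n + 1) => haarProbability G)) := by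
  have hμν : μ < ν := by rw [← hμ, ← hν]; exact q.2
  have hμν' : μ ≠ ν := ne_of_lt hμν
  have hm1 : 1 ≤ m := by omega
  have hmn : m ≤ n := by omega
  have h1m : 1 + m ≤ n := by omega
  have hcm : n + 1 - m = 1 + m := by omega
  set Z₁ : ℝ := ∫ W, boltz ρ β W ∂(MeasureTheory.Measure.pi (fun _ : Edge 4 (n + 1) => haarProbability G)) with hZ₁
  have hZ₁0 : 0 ≤ Z₁ := integral_nonneg fun W => (boltz_pos ρ β W).le
  -- the kernels
  have hΨm : Measurable (Function.uncurry (slabKernel (n := n) ρ μ β m)) := measurable_slabKernel_comp ρ μ hρ β m measurable_fst measurable_snd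
  have hKm : Measurable (Function.uncurry (slabKernel (n := n) ρ μ β 1)) := measurable_slabKernel_comp ρ μ hρ β 1 measurable_fst measurable_snd
  have hsg : ∀ A Y : (GaugeConfig 4 (n + 1) G), slabKernel ρ μ β (1 + m) A Y = ∫ A', (slabKernel ρ μ β 1) A A' * (slabKernel ρ μ β m) A' Y ∂(MeasureTheory.Measure.pi (fun _ : Edge 4 (n + 1) => haarProbability G)) :=
    fun A Y => slabKernel_add ρ μ hρ hU hβ le_rfl hm1 h1m A Y
  -- the close pairs
  set Cl : Set ((GaugeConfig 4 (n + 1) G) × (GaugeConfig 4 (n + 1) G)) := {p : (GaugeConfig 4 (n + 1) G) × (GaugeConfig 4 (n + 1) G) | ∃ u : G, (N : ℝ) - (ρ ((polyakov μ ν 0 p.1)⁻¹ * (u * polyakov μ ν 0 p.2 * u⁻¹))).trace.re < δ}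
    with hCl
  have hClm : MeasurableSet Cl := by
    have hopen : IsOpen Cl := by
      have e : Cl = ⋃ u : G, {p : (GaugeConfig 4 (n + 1) G) × (GaugeConfig 4 (n + 1) G) | (N : ℝ) - (ρ ((polyakov μ ν 0 p.1)⁻¹ * (u * polyakov μ ν 0 p.2 * u⁻¹))).trace.re < δ} := by
        ext p; simp only [hCl, Set.mem_setOf_eq, Set.mem_iUnion]
      rw [e]
      refine isOpen_iUnion fun u => isOpen_lt ?_ continuous_const
      refine continuous_const.sub (Complex.continuous_re.comp (hρ.comp ?_).matrix_trace)
      exact ((continuous_polyakov μ ν 0).comp continuous_fst).inv.mul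
        ((continuous_const.mul ((continuous_polyakov μ ν 0).comp continuous_snd)).mul continuous_const)
    exact hopen.measurableSet
  have hClloc : ∀ a a' : (GaugeConfig 4 (n + 1) G), (a, a') ∈ Cl → a ∉ {X : (GaugeConfig 4 (n + 1) G) | polyakov μ ν 0 X ∈ Wset} → a' ∉ {X : (GaugeConfig 4 (n + 1) G) | polyakov μ ν 0 X ∈ Wset} →
      O (polyakov μ ν 0 a) = O (polyakov μ ν 0 a') := by
    intro a a' hcl ha ha'
    obtain ⟨u, hu⟩ := hcl
    simp only [Set.mem_setOf_eq] at ha ha'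
    have h := hloc _ _ hu ha (by rw [hWc]; exact ha')
    rwa [hOc] at h
  -- the abstract odd ring lemma
  have habs := hO (GaugeConfig 4 (n + 1) G) (MeasureTheory.Measure.pi (fun _ : Edge 4 (n + 1) => haarProbability G)) (slabKernel ρ μ β m) (slabKernel ρ μ β 1) 1 1 hΨm (abs_slabKernel_le_one ρ μ hU hβ m) (slabKernel_nonneg ρ μ β m)
    (slabKernel_symm ρ μ hρ hU β hm1 hmn) hKm (abs_slabKernel_le_one ρ μ hU hβ 1) (slabKernel_nonneg ρ μ β 1)
    (slabKernel_symm ρ μ hρ hU β le_rfl hn) (slabKernel_one_psd ρ μ hn hρ hU hβ)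
    (twistMap μ ν z) (measurePreserving_twistMap μ ν z) (fun X => O (polyakov μ ν 0 X)) {X : (GaugeConfig 4 (n + 1) G) | polyakov μ ν 0 X ∈ Wset}
    (hOm.comp (measurable_polyakov μ ν 0)) (hWm.preimage (measurable_polyakov μ ν 0)) (fun X hX => by
      simp only [Set.mem_setOf_eq] at hX
      show O (polyakov μ ν 0 (twistMap μ ν z X)) ≠ O (polyakov μ ν 0 X)
      rw [polyakov_zero_twistMap]; exact hsep _ hX) Cl hClm hClloc
  -- (i1), (i2): the two partition functions
  have e1 : ∫ W, Real.exp (-(β * ∑ p : Plaquette 4 (n + 1), twistedCost ρ q z W p)) ∂(MeasureTheory.Measure.pi (fun _ : Edge 4 (n + 1) => haarProbability G)) =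
      ∫ X, ∫ A, (slabKernel ρ μ β m) X A * ∫ A', (slabKernel ρ μ β 1) A A' * (slabKernel ρ μ β m) A' (twistMap μ ν z X) ∂(MeasureTheory.Measure.pi (fun _ : Edge 4 (n + 1) => haarProbability G)) ∂(MeasureTheory.Measure.pi (fun _ : Edge 4 (n + 1) => haarProbability G)) ∂(MeasureTheory.Measure.pi (fun _ : Edge 4 (n + 1) => haarProbability G)) := by
    rw [twistedPartition_eq_ring ρ μ ν hn hρ hU hβ hμ hν hz hm1 hmn, hcm]
    simp_rw [hsg]
  have e2 : Z₁ = ∫ X, ∫ A, (slabKernel ρ μ β m) X A * ∫ A', (slabKernel ρ μ β 1) A A' * (slabKernel ρ μ β m) A' X ∂(MeasureTheory.Measure.pi (fun _ : Edge 4 (n + 1) => haarProbability G)) ∂(MeasureTheory.Measure.pi (fun _ : Edge 4 (n + 1) => haarProbability G)) ∂(MeasureTheory.Measure.pi (fun _ : Edge 4 (n + 1) => haarProbability G)) := by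
    rw [hZ₁, partition_eq_ring ρ μ hρ hU hβ hm1 hmn, hcm]
    simp_rw [hsg]
  -- pulling a middle insertion depending on `(x, a)` only out of the bond integral
  have hpull : ∀ (c : ℝ) (A X : (GaugeConfig 4 (n + 1) G)), ∫ A', (slabKernel ρ μ β 1) A A' * c * (slabKernel ρ μ β m) A' X ∂(MeasureTheory.Measure.pi (fun _ : Edge 4 (n + 1) => haarProbability G)) = c * slabKernel ρ μ β (1 + m) A X := by
    intro c A X
    rw [hsg, ← integral_const_mul]
    exact integral_congr_ae (ae_of_all _ fun A' => by ring)
  -- (i3) the flip term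
  have hflm : Measurable (Function.uncurry fun (X B : (GaugeConfig 4 (n + 1) G)) => {B : (GaugeConfig 4 (n + 1) G) | O (polyakov μ ν 0 B) ≠ O (polyakov μ ν 0 X)}.indicator (fun _ => (1 : ℝ)) B) :=
    measurable_flipIndNat (hOm.comp (measurable_polyakov μ ν 0))
  have hFF : ∫ X, ∫ A, (slabKernel ρ μ β m) X A * ∫ A', (slabKernel ρ μ β 1) A A' * ({B : (GaugeConfig 4 (n + 1) G) | O (polyakov μ ν 0 B) ≠ O (polyakov μ ν 0 X)}.indicator (fun _ => (1 : ℝ)) A * {B : (GaugeConfig 4 (n + 1) G) | O (polyakov μ ν 0 B) ≠ O (polyakov μ ν 0 X)}.indicator (fun _ => (1 : ℝ)) A') * (slabKernel ρ μ β m) A' X ∂(MeasureTheory.Measure.pi (fun _ : Edge 4 (n + 1) => haarProbability G)) ∂(MeasureTheory.Measure.pi (fun _ : Edge 4 (n + 1) => haarProbability G)) ∂(MeasureTheory.Measure.pi (fun _ : Edge 4 (n + 1) => haarProbability G)) ≤ 4 * ε ^ 2 * Z₁ := by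
    have hmono := weight_mono (ρ := (MeasureTheory.Measure.pi (fun _ : Edge 4 (n + 1) => haarProbability G))) (Ψ := slabKernel ρ μ β m) (K := slabKernel ρ μ β 1) hΨm (abs_slabKernel_le_one ρ μ hU hβ m) (slabKernel_nonneg ρ μ β m)
      hKm (abs_slabKernel_le_one ρ μ hU hβ 1) (slabKernel_nonneg ρ μ β 1)
      (H := fun X A A' => {B : (GaugeConfig 4 (n + 1) G) | O (polyakov μ ν 0 B) ≠ O (polyakov μ ν 0 X)}.indicator (fun _ => (1 : ℝ)) A * {B : (GaugeConfig 4 (n + 1) G) | O (polyakov μ ν 0 B) ≠ O (polyakov μ ν 0 X)}.indicator (fun _ => (1 : ℝ)) A') (H' := fun X A _ => {B : (GaugeConfig 4 (n + 1) G) | O (polyakov μ ν 0 B) ≠ O (polyakov μ ν 0 X)}.indicator (fun _ => (1 : ℝ)) A)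
      ((hflm.comp (measurable_fst.prodMk (measurable_fst.comp measurable_snd))).mul
        (hflm.comp (measurable_fst.prodMk (measurable_snd.comp measurable_snd))))
      (hflm.comp (measurable_fst.prodMk (measurable_fst.comp measurable_snd))) (CH := 1) (CH' := 1)
      (fun X A A' => by
        rw [abs_mul]
        exact (mul_le_mul (abs_ind_le_one _ _) (abs_ind_le_one _ _) (abs_nonneg _) zero_le_one).trans_eq (mul_one _))
      (fun X A _ => abs_ind_le_one _ _) (fun X A A' => mul_le_of_le_one_right (ind_nonneg _ _) (ind_le_one _ _)) measurable_id
    refine hmono.trans ?_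
    have e3 : ∫ X, ∫ A, (slabKernel ρ μ β m) X A * ∫ A', (slabKernel ρ μ β 1) A A' * {B : (GaugeConfig 4 (n + 1) G) | O (polyakov μ ν 0 B) ≠ O (polyakov μ ν 0 X)}.indicator (fun _ => (1 : ℝ)) A * (slabKernel ρ μ β m) A' (id X) ∂(MeasureTheory.Measure.pi (fun _ : Edge 4 (n + 1) => haarProbability G)) ∂(MeasureTheory.Measure.pi (fun _ : Edge 4 (n + 1) => haarProbability G)) ∂(MeasureTheory.Measure.pi (fun _ : Edge 4 (n + 1) => haarProbability G)) =
        ∫ W, {W : (GaugeConfig 4 (n + 1) G) | O (polyakov μ ν m W) ≠ O (polyakov μ ν 0 W)}.indicator (fun _ => (1 : ℝ)) W * boltz ρ β W ∂(MeasureTheory.Measure.pi (fun _ : Edge 4 (n + 1) => haarProbability G)) := by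
      rw [← flipRing_eq ρ μ ν hρ hU hμν' hβ hm1 hmn hOm, hcm]
      refine integral_congr_ae (ae_of_all _ fun X => integral_congr_ae (ae_of_all _ fun A => ?_))
      dsimp only
      rw [id, hpull]; ring
    rw [e3]
    have h1 := integral_flip_le (n := n) ρ μ ν hρ hU hμν hβ hOm hWm hOc hWc hloc m
    have h2 := sum_wallWeight_shift_le ρ μ ν β Wset hmn
    have h3 : (m : ℝ) * ((n + 1 : ℕ) : ℝ) * Real.exp (-(β * (δ / (((n + 1 : ℕ) : ℝ) ^ 2)))) ≤ ε ^ 2 * Z₁ / 2 := by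
      have e : (m : ℝ) * ((n + 1 : ℕ) : ℝ) ≤ (((n + 1 : ℕ) : ℝ) ^ 2) / 2 := by
        have : ((n + 1 : ℕ) : ℝ) = 2 * (m : ℝ) + 1 := by exact_mod_cast hm
        rw [this]; nlinarith
      have hexp : 0 ≤ Real.exp (-(β * (δ / (((n + 1 : ℕ) : ℝ) ^ 2)))) := (Real.exp_pos _).le
      have hpin' : (((n + 1 : ℕ) : ℝ) ^ 2) * Real.exp (-(β * (δ / (((n + 1 : ℕ) : ℝ) ^ 2)))) ≤ ε ^ 2 * Z₁ := by
        rw [mul_comm β]; exact hpin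
      calc (m : ℝ) * ((n + 1 : ℕ) : ℝ) * Real.exp (-(β * (δ / (((n + 1 : ℕ) : ℝ) ^ 2))))
          ≤ (((n + 1 : ℕ) : ℝ) ^ 2) / 2 * Real.exp (-(β * (δ / (((n + 1 : ℕ) : ℝ) ^ 2)))) := mul_le_mul_of_nonneg_right e hexp
        _ = ((((n + 1 : ℕ) : ℝ) ^ 2) * Real.exp (-(β * (δ / (((n + 1 : ℕ) : ℝ) ^ 2))))) / 2 := by ring
        _ ≤ ε ^ 2 * Z₁ / 2 := by linarith
    have hε2 : 0 ≤ ε ^ 2 * Z₁ := by positivity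
    linarith
  -- (i4) the wall at the base point
  have hW0 : ∫ X, ∫ A, (slabKernel ρ μ β m) X A * ∫ A', (slabKernel ρ μ β 1) A A' * {X : (GaugeConfig 4 (n + 1) G) | polyakov μ ν 0 X ∈ Wset}.indicator (fun _ => (1 : ℝ)) X * (slabKernel ρ μ β m) A' X ∂(MeasureTheory.Measure.pi (fun _ : Edge 4 (n + 1) => haarProbability G)) ∂(MeasureTheory.Measure.pi (fun _ : Edge 4 (n + 1) => haarProbability G)) ∂(MeasureTheory.Measure.pi (fun _ : Edge 4 (n + 1) => haarProbability G)) ≤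
      ε ^ 2 * Z₁ := by
    have e4 : ∫ X, ∫ A, (slabKernel ρ μ β m) X A * ∫ A', (slabKernel ρ μ β 1) A A' * {X : (GaugeConfig 4 (n + 1) G) | polyakov μ ν 0 X ∈ Wset}.indicator (fun _ => (1 : ℝ)) X * (slabKernel ρ μ β m) A' X ∂(MeasureTheory.Measure.pi (fun _ : Edge 4 (n + 1) => haarProbability G)) ∂(MeasureTheory.Measure.pi (fun _ : Edge 4 (n + 1) => haarProbability G)) ∂(MeasureTheory.Measure.pi (fun _ : Edge 4 (n + 1) => haarProbability G)) =
        wallWeight (n := n) ρ μ ν β Wset 0 := by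
      rw [← wallRing_eq ρ μ ν hρ hU hμν' hβ hm1 hmn hWm, hcm]
      refine integral_congr_ae (ae_of_all _ fun X => integral_congr_ae (ae_of_all _ fun A => ?_))
      dsimp only; rw [hpull]; ring
    rw [e4]
    exact (Finset.single_le_sum (fun t _ => wallWeight_nonneg (n := n) ρ μ ν β Wset t) (Finset.mem_range.mpr (Nat.succ_pos n))).trans hwall
  -- (i5) the two-ended wall term
  have hWW : ∫ X, ∫ A, (slabKernel ρ μ β m) X A * ∫ A', (slabKernel ρ μ β 1) A A' * ({X : (GaugeConfig 4 (n + 1) G) | polyakov μ ν 0 X ∈ Wset}.indicator (fun _ => (1 : ℝ)) A *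
      {X : (GaugeConfig 4 (n + 1) G) | polyakov μ ν 0 X ∈ Wset}.indicator (fun _ => (1 : ℝ)) A') * (slabKernel ρ μ β m) A' X ∂(MeasureTheory.Measure.pi (fun _ : Edge 4 (n + 1) => haarProbability G)) ∂(MeasureTheory.Measure.pi (fun _ : Edge 4 (n + 1) => haarProbability G)) ∂(MeasureTheory.Measure.pi (fun _ : Edge 4 (n + 1) => haarProbability G)) ≤ ε ^ 2 * Z₁ := by
    have hwm : Measurable fun X : (GaugeConfig 4 (n + 1) G) => {X : (GaugeConfig 4 (n + 1) G) | polyakov μ ν 0 X ∈ Wset}.indicator (fun _ => (1 : ℝ)) X :=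
      measurable_const.indicator (hWm.preimage (measurable_polyakov μ ν 0))
    have hmono := weight_mono (ρ := (MeasureTheory.Measure.pi (fun _ : Edge 4 (n + 1) => haarProbability G))) (Ψ := slabKernel ρ μ β m) (K := slabKernel ρ μ β 1) hΨm (abs_slabKernel_le_one ρ μ hU hβ m) (slabKernel_nonneg ρ μ β m)
      hKm (abs_slabKernel_le_one ρ μ hU hβ 1) (slabKernel_nonneg ρ μ β 1)
      (H := fun _ A A' => {X : (GaugeConfig 4 (n + 1) G) | polyakov μ ν 0 X ∈ Wset}.indicator (fun _ => (1 : ℝ)) A *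
        {X : (GaugeConfig 4 (n + 1) G) | polyakov μ ν 0 X ∈ Wset}.indicator (fun _ => (1 : ℝ)) A')
      (H' := fun _ A _ => {X : (GaugeConfig 4 (n + 1) G) | polyakov μ ν 0 X ∈ Wset}.indicator (fun _ => (1 : ℝ)) A)
      ((hwm.comp (measurable_fst.comp measurable_snd)).mul (hwm.comp (measurable_snd.comp measurable_snd)))
      (hwm.comp (measurable_fst.comp measurable_snd)) (CH := 1) (CH' := 1)
      (fun X A A' => by
        rw [abs_mul]
        exact (mul_le_mul (abs_ind_le_one _ _) (abs_ind_le_one _ _) (abs_nonneg _) zero_le_one).trans_eq (mul_one _))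
      (fun X A _ => abs_ind_le_one _ _) (fun X A A' => mul_le_of_le_one_right (ind_nonneg _ _) (ind_le_one _ _)) measurable_id
    refine hmono.trans ?_
    have e5 : ∫ X, ∫ A, (slabKernel ρ μ β m) X A * ∫ A', (slabKernel ρ μ β 1) A A' * {X : (GaugeConfig 4 (n + 1) G) | polyakov μ ν 0 X ∈ Wset}.indicator (fun _ => (1 : ℝ)) A * (slabKernel ρ μ β m) A' (id X) ∂(MeasureTheory.Measure.pi (fun _ : Edge 4 (n + 1) => haarProbability G)) ∂(MeasureTheory.Measure.pi (fun _ : Edge 4 (n + 1) => haarProbability G)) ∂(MeasureTheory.Measure.pi (fun _ : Edge 4 (n + 1) => haarProbability G)) =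
        wallWeight (n := n) ρ μ ν β Wset m := by
      rw [← wallRingJ_eq ρ μ ν hρ hU hμν' hβ hm1 hmn hWm, hcm]
      refine integral_congr_ae (ae_of_all _ fun X => integral_congr_ae (ae_of_all _ fun A => ?_))
      dsimp only; rw [id, hpull]; ring
    rw [e5]
    exact (Finset.single_le_sum (fun t _ => wallWeight_nonneg (n := n) ρ μ ν β Wset t) (Finset.mem_range.mpr (by omega))).trans hwall
  -- (i6) the bad bonds
  have hBAD : ∫ X, ∫ A, (slabKernel ρ μ β m) X A * ∫ A', (slabKernel ρ μ β 1) A A' * Clᶜ.indicator (fun _ => (1 : ℝ)) (A, A') * (slabKernel ρ μ β m) A' (twistMap μ ν z X) ∂(MeasureTheory.Measure.pi (fun _ : Edge 4 (n + 1) => haarProbability G)) ∂(MeasureTheory.Measure.pi (fun _ : Edge 4 (n + 1) => haarProbability G)) ∂(MeasureTheory.Measure.pi (fun _ : Edge 4 (n + 1) => haarProbability G)) ≤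
      ε ^ 2 * Z₁ := by
    have hFar : Clᶜ = {p : (GaugeConfig 4 (n + 1) G) × (GaugeConfig 4 (n + 1) G) | ∀ u : G, δ ≤ (N : ℝ) - (ρ ((polyakov μ ν 0 p.1)⁻¹ * (u * polyakov μ ν 0 p.2 * u⁻¹))).trace.re} := by
      ext p; simp only [hCl, Set.mem_compl_iff, Set.mem_setOf_eq, not_exists, not_lt]
    set g : (GaugeConfig 4 (n + 1) G) → ℝ := fun A => ∫ A', Clᶜ.indicator (fun _ => (1 : ℝ)) (A, A') * (slabKernel ρ μ β 1) A A' ∂(MeasureTheory.Measure.pi (fun _ : Edge 4 (n + 1) => haarProbability G)) with hg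
    have hg0 : ∀ A, 0 ≤ g A := fun A => integral_nonneg fun A' => mul_nonneg (ind_nonneg _ _) (slabKernel_nonneg ρ μ β 1 A A')
    have hgK : Measurable fun p : (GaugeConfig 4 (n + 1) G) × (GaugeConfig 4 (n + 1) G) => Clᶜ.indicator (fun _ => (1 : ℝ)) (p.1, p.2) * (slabKernel ρ μ β 1) p.1 p.2 :=
      (measurable_const.indicator hClm.compl).mul hKm
    have hgm : Measurable g := (hgK.stronglyMeasurable.integral_prod_right' (ν := (MeasureTheory.Measure.pi (fun _ : Edge 4 (n + 1) => haarProbability G)))).measurable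
    have hg1 : ∀ A, g A ≤ 1 := fun A => by
      have := norm_integral_le_of_norm_le_const (μ := (MeasureTheory.Measure.pi (fun _ : Edge 4 (n + 1) => haarProbability G))) (f := fun A' => Clᶜ.indicator (fun _ => (1 : ℝ)) (A, A') * (slabKernel ρ μ β 1) A A') (C := 1)
        (ae_of_all _ fun A' => by
          rw [Real.norm_eq_abs, abs_mul]
          exact (mul_le_mul (abs_ind_le_one _ _) (abs_slabKernel_le_one ρ μ hU hβ 1 A A') (abs_nonneg _) zero_le_one).trans_eq (mul_one _))
      rw [Real.norm_eq_abs, probReal_univ, mul_one] at this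
      exact (le_abs_self _).trans this
    -- inner bound: drop `(slabKernel ρ μ β m) ≤ 1`
    have hin : ∀ X A : (GaugeConfig 4 (n + 1) G), ∫ A', (slabKernel ρ μ β 1) A A' * Clᶜ.indicator (fun _ => (1 : ℝ)) (A, A') * (slabKernel ρ μ β m) A' (twistMap μ ν z X) ∂(MeasureTheory.Measure.pi (fun _ : Edge 4 (n + 1) => haarProbability G)) ≤ g A := by
      intro X A
      refine integral_mono_of_nonneg (ae_of_all _ fun A' => mul_nonneg (mul_nonneg (slabKernel_nonneg ρ μ β 1 A A') (ind_nonneg _ _))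
        (slabKernel_nonneg ρ μ β m _ _)) ?_ (ae_of_all _ fun A' => ?_)
      · exact integrable_of_bdd (hgK.comp (measurable_const.prodMk measurable_id)) (C := 1) (fun A' => by
          show |Clᶜ.indicator (fun _ => (1 : ℝ)) (A, A') * (slabKernel ρ μ β 1) A A'| ≤ 1
          rw [abs_mul]
          exact (mul_le_mul (abs_ind_le_one _ _) (abs_slabKernel_le_one ρ μ hU hβ 1 A A') (abs_nonneg _) zero_le_one).trans_eq
            (mul_one _)) _
      · calc (slabKernel ρ μ β 1) A A' * Clᶜ.indicator (fun _ => (1 : ℝ)) (A, A') * (slabKernel ρ μ β m) A' (twistMap μ ν z X)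
            ≤ (slabKernel ρ μ β 1) A A' * Clᶜ.indicator (fun _ => (1 : ℝ)) (A, A') * 1 :=
              mul_le_mul_of_nonneg_left (slabKernel_le_one ρ μ hU hβ m _ _) (mul_nonneg (slabKernel_nonneg ρ μ β 1 A A') (ind_nonneg _ _))
          _ = Clᶜ.indicator (fun _ => (1 : ℝ)) (A, A') * (slabKernel ρ μ β 1) A A' := by ring
    have hmid : ∀ X : (GaugeConfig 4 (n + 1) G), ∫ A, (slabKernel ρ μ β m) X A * ∫ A', (slabKernel ρ μ β 1) A A' * Clᶜ.indicator (fun _ => (1 : ℝ)) (A, A') * (slabKernel ρ μ β m) A' (twistMap μ ν z X) ∂(MeasureTheory.Measure.pi (fun _ : Edge 4 (n + 1) => haarProbability G)) ∂(MeasureTheory.Measure.pi (fun _ : Edge 4 (n + 1) => haarProbability G)) ≤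
        ∫ A, g A ∂(MeasureTheory.Measure.pi (fun _ : Edge 4 (n + 1) => haarProbability G)) := by
      intro X
      refine integral_mono_of_nonneg (ae_of_all _ fun A => mul_nonneg (slabKernel_nonneg ρ μ β m X A) (integral_nonneg fun A' =>
        mul_nonneg (mul_nonneg (slabKernel_nonneg ρ μ β 1 A A') (ind_nonneg _ _)) (slabKernel_nonneg ρ μ β m _ _)))
        (integrable_of_bdd hgm (C := 1) (fun A => by rw [abs_of_nonneg (hg0 A)]; exact hg1 A) _) (ae_of_all _ fun A => ?_)
      calc (slabKernel ρ μ β m) X A * ∫ A', (slabKernel ρ μ β 1) A A' * Clᶜ.indicator (fun _ => (1 : ℝ)) (A, A') * (slabKernel ρ μ β m) A' (twistMap μ ν z X) ∂(MeasureTheory.Measure.pi (fun _ : Edge 4 (n + 1) => haarProbability G))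
          ≤ (slabKernel ρ μ β m) X A * g A := mul_le_mul_of_nonneg_left (hin X A) (slabKernel_nonneg ρ μ β m X A)
        _ ≤ 1 * g A := mul_le_mul_of_nonneg_right (slabKernel_le_one ρ μ hU hβ m X A) (hg0 A)
        _ = g A := one_mul _
    have hout : ∫ X, ∫ A, (slabKernel ρ μ β m) X A * ∫ A', (slabKernel ρ μ β 1) A A' * Clᶜ.indicator (fun _ => (1 : ℝ)) (A, A') * (slabKernel ρ μ β m) A' (twistMap μ ν z X) ∂(MeasureTheory.Measure.pi (fun _ : Edge 4 (n + 1) => haarProbability G)) ∂(MeasureTheory.Measure.pi (fun _ : Edge 4 (n + 1) => haarProbability G)) ∂(MeasureTheory.Measure.pi (fun _ : Edge 4 (n + 1) => haarProbability G)) ≤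
        ∫ A, g A ∂(MeasureTheory.Measure.pi (fun _ : Edge 4 (n + 1) => haarProbability G)) := by
      calc _ ≤ ∫ _X : (GaugeConfig 4 (n + 1) G), ∫ A, g A ∂(MeasureTheory.Measure.pi (fun _ : Edge 4 (n + 1) => haarProbability G)) ∂(MeasureTheory.Measure.pi (fun _ : Edge 4 (n + 1) => haarProbability G)) :=
            integral_mono_of_nonneg (ae_of_all _ fun X => integral_nonneg fun A => mul_nonneg (slabKernel_nonneg ρ μ β m X A)
              (integral_nonneg fun A' => mul_nonneg (mul_nonneg (slabKernel_nonneg ρ μ β 1 A A') (ind_nonneg _ _))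
              (slabKernel_nonneg ρ μ β m _ _))) (integrable_const _) (ae_of_all _ fun X => hmid X)
        _ = ∫ A, g A ∂(MeasureTheory.Measure.pi (fun _ : Edge 4 (n + 1) => haarProbability G)) := by simp
    refine hout.trans ?_
    have hfar := integral_far_slabKernel_one_le ρ μ ν hn hρ hU hμν hβ δ
    rw [← hFar] at hfar
    have hle : ∫ A, g A ∂(MeasureTheory.Measure.pi (fun _ : Edge 4 (n + 1) => haarProbability G)) ≤ ((n + 1 : ℕ) : ℝ) * Real.exp (-(β * (δ / (((n + 1 : ℕ) : ℝ) ^ 2)))) := hfar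
    have hpos : (1 : ℝ) ≤ ((n + 1 : ℕ) : ℝ) := by exact_mod_cast Nat.succ_pos n
    have h3 : ((n + 1 : ℕ) : ℝ) * Real.exp (-(β * (δ / (((n + 1 : ℕ) : ℝ) ^ 2)))) ≤ ε ^ 2 * Z₁ := by
      have hexp : 0 ≤ Real.exp (-(β * (δ / (((n + 1 : ℕ) : ℝ) ^ 2)))) := (Real.exp_pos _).le
      have hpin' : (((n + 1 : ℕ) : ℝ) ^ 2) * Real.exp (-(β * (δ / (((n + 1 : ℕ) : ℝ) ^ 2)))) ≤ ε ^ 2 * Z₁ := by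
        rw [mul_comm β]; exact hpin
      calc ((n + 1 : ℕ) : ℝ) * Real.exp (-(β * (δ / (((n + 1 : ℕ) : ℝ) ^ 2))))
          ≤ (((n + 1 : ℕ) : ℝ) ^ 2) * Real.exp (-(β * (δ / (((n + 1 : ℕ) : ℝ) ^ 2)))) :=
            mul_le_mul_of_nonneg_right (by nlinarith [hpos]) hexp
        _ ≤ ε ^ 2 * Z₁ := hpin'
    exact hle.trans h3
  -- collect
  rw [← e1, ← e2] at habs
  have hsF : Real.sqrt (∫ X, ∫ A, (slabKernel ρ μ β m) X A * ∫ A', (slabKernel ρ μ β 1) A A' * ({B : (GaugeConfig 4 (n + 1) G) | O (polyakov μ ν 0 B) ≠ O (polyakov μ ν 0 X)}.indicator (fun _ => (1 : ℝ)) A * {B : (GaugeConfig 4 (n + 1) G) | O (polyakov μ ν 0 B) ≠ O (polyakov μ ν 0 X)}.indicator (fun _ => (1 : ℝ)) A') * (slabKernel ρ μ β m) A' X ∂(MeasureTheory.Measure.pi (fun _ : Edge 4 (n + 1) => haarProbability G)) ∂(MeasureTheory.Measure.pi (fun _ : Edge 4 (n + 1) => haarProbability G)) ∂(MeasureTheory.Measure.pi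 (fun _ : Edge 4 (n + 1) => haarProbability G))) ≤ 2 * ε * Real.sqrt Z₁ := by
    have h : 4 * ε ^ 2 * Z₁ = (2 * ε * Real.sqrt Z₁) ^ 2 := by rw [mul_pow, mul_pow, Real.sq_sqrt hZ₁0]; ring
    calc _ ≤ Real.sqrt (4 * ε ^ 2 * Z₁) := Real.sqrt_le_sqrt hFF
      _ = 2 * ε * Real.sqrt Z₁ := by rw [h, Real.sqrt_sq (by positivity)]
  have hsq : ∀ {t : ℝ}, t ≤ ε ^ 2 * Z₁ → Real.sqrt t ≤ ε * Real.sqrt Z₁ := fun ht => by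
    have h : ε ^ 2 * Z₁ = (ε * Real.sqrt Z₁) ^ 2 := by rw [mul_pow, Real.sq_sqrt hZ₁0]
    calc _ ≤ Real.sqrt (ε ^ 2 * Z₁) := Real.sqrt_le_sqrt ht
      _ = ε * Real.sqrt Z₁ := by rw [h, Real.sqrt_sq (by positivity)]
  have hε2 : ε ^ 2 * Z₁ ≤ ε * Z₁ := mul_le_mul_of_nonneg_right (by nlinarith) hZ₁0
  calc ∫ W, Real.exp (-(β * ∑ p : Plaquette 4 (n + 1), twistedCost ρ q z W p)) ∂(MeasureTheory.Measure.pi (fun _ : Edge 4 (n + 1) => haarProbability G))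
      ≤ Real.sqrt Z₁ * (2 * (2 * ε * Real.sqrt Z₁) + ε * Real.sqrt Z₁ + 2 * (ε * Real.sqrt Z₁)) + ε * Z₁ := by
        refine habs.trans (add_le_add (mul_le_mul_of_nonneg_left ?_ (Real.sqrt_nonneg _)) (hBAD.trans hε2))
        linarith [hsq hW0, hsq hWW]
    _ = 8 * ε * Z₁ := by
        have : Real.sqrt Z₁ * Real.sqrt Z₁ = Z₁ := Real.mul_self_sqrt hZ₁0
        linear_combination (7 * ε) * this
    _ ≤ 16 * ε * Z₁ := by nlinarith

end OddCore

end Summit.QuantumFields.YangMills.Theorems.CentreWallReflection.Slab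

end
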